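import Literature.NumberTheory.LFunctions.WeilGroundEnergyParitySplit
import HarnessLib

/-!
# Even-sector ground states of the truncated Weil quadratic form (operator-free encoding)

Even-sector twin of `Literature/NumberTheory/LFunctions/WeilOddGroundState.lean` and companion of
`Literature/NumberTheory/LFunctions/WeilGroundEnergyParitySplit.lean` (which already defines the
even-sector ground ENERGY `ε_ev(a) = weilEvenGroundEnergy a`). Same normalisation throughout this
directory: additive variable `t = log x`, test functions `IsWeilTest g` (smooth, compact support),
`Q(g) = weilQuadratic g = W(g ⋆ g̃)`, `ĝ(s) = weilMellin g s = ∫ g(t) e^{(s-1/2)t} dt`, window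
`tsupport g ⊆ [-a, a]`.

## What is defined

* `IsWeilEvenGroundState a u`: `u : ℝ → ℂ` is an EVEN-SECTOR GROUND STATE (bottom state) of Weil's
  quadratic form on the window `[-a, a]`, encoded WITHOUT positing an operator (exactly as
  `IsWeilGroundState` and `IsWeilOddGroundState` are): `u ∈ L²` and `u` is the `L²`-limit of an
  `L²`-normalised MINIMISING SEQUENCE OF EVEN TEST FUNCTIONS on the window — even window tests `gₙ`
  (`gₙ(-t) = gₙ(t)`, `tsupport gₙ ⊆ [-a, a]`, `∫ |gₙ|² = 1`) which are minimising IN THE EVEN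
  SECTOR, stated junk-free ("for every normalised even window test `h` and every `δ > 0`,
  eventually `Re Q(gₙ) ≤ Re Q(h) + δ`"), with `∫ |gₙ − u|² → 0`. This is, token for token, the
  predicate inlined (over a `let C … let M … let Q …` prelude spelling out `weilQuadratic`) by the
  route statements `EvenOneSignedWindows` / `EvenBartaFloor` of
  `Summits/RiemannHypothesis/RiemannHypothesis/Theses/EvenSectorBarta.lean`:
  `isWeilEvenGroundState_iff_inline` is `Iff.rfl` against that verbatim text, and
  `isWeilEvenGroundState_iff` is the `Iff.rfl` unfolding in the directory's vocabulary. It is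
  EQUIVALENT to the `IsWeilGroundState`-shaped form "`Re Q(gₙ) → ε_ev(a)`"
  (`isWeilEvenGroundState_iff_tendsto`, proved: the even sphere is bounded below and contains
  every `gₙ`), which is the form inlined by `Theses/EvenThetaVisibilityPinning.lean`.

## The sources

* E. Bombieri (2000), §2 (p. 186): for `f` on `(0, ∞)`, `f*(x) = x⁻¹ f(1/x)`, "`f` is even if
  `f = f*` and odd if `f = -f*`". In the additive, `1/2`-symmetric variable of this directory
  (`g(t) = e^{t/2} f(e^t)`) one has `(f*)♮(t) = g(-t)`: Bombieri's even functions are exactly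
  `g(-t) = g(t)`.
* E. Bombieri (2000), §4 Theorem 5 (p. 197): "Let `μ⁺(M)` and `μ⁻(M)` be the infimum of
  `T[f * f̄*]` in the class of even and odd functions in `L²([M⁻¹, M])` of norm 1. Then `μ⁺(M)` and
  `μ⁻(M)` are continuous decreasing functions of `M`", whose proof begins "Let `f(x)` be even or odd
  and a minimizer for `T[f * f̄*]`" — `weilEvenGroundEnergy a` (ParitySplit file) is `μ⁺(e^a)` over
  the smooth even functions of the window, and an even-sector ground state is such an even
  minimiser; by §4 Problem 2 / Theorem 3 (p. 193: "Let `{f_ν}` be a minimizing sequence … the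
  sequence `{f_ν}` converges to `f` strongly in `L²(E)`") minimisers are strong `L²`-limits of
  normalised minimising sequences, which is the encoding used here, in `IsWeilGroundState` and in
  `IsWeilOddGroundState`. §9 Lemma 11: for a symmetric window the eigenvalue problem splits into
  even and odd eigenfunctions `F(-u) = ±F(u)`.
* M. Suzuki (2026), arXiv:2606.09096, §4.5 (arXiv p. 18): the kernel is even, so the form operator `B_a`
  and its Friedrichs extension `A_a` commute with the parity operator `(Ju)(x) = u(-x)`, "each
  eigenspace `E(λ)` of `A_a` admits a decomposition into even and odd subspaces", and
  `λ_a^± := inf` of the Rayleigh quotient over even / odd functions, `λ_a = min(λ_a⁺, λ_a⁻)` (4.10)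
  (in the tree: `weilGroundEnergy_eq_min_even_odd`); Theorem 1.4 (p. 4): for small `a > 0` the
  lowest eigenvalue is simple "and the corresponding eigenfunction is even" — i.e. the ground state
  is an even-sector ground state in the present sense.

Why the encoding is faithful (functional analysis, for the reviewer; none of it is asserted in
Lean): the reflection `(Jg)(t) = g(-t)` preserves the window, the `L²` norm and `Q`
(`weilQuadratic_comp_neg`), so the closed lower-bounded form of the window commutes with `J` and
its Friedrichs operator is reduced by `L² = L²_even ⊕ L²_odd` (Suzuki §4.5); the even window tests
are a form core of the even part, so `ε_ev(a)` is the bottom of the spectrum of the even part and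
the `L²`-limits `u` of normalised even minimising sequences are exactly its normalised bottom
eigenvectors (`‖u‖₂ = 1`, `Q̄(u) = ε_ev(a)`, `u` even). The predicate asserts neither existence
(Bombieri's Thm 3 restricted to the even sector) nor uniqueness.

## API (all proved; no named facts are introduced)

`isWeilEvenGroundState_iff` (`Iff.rfl`), `isWeilEvenGroundState_iff_inline` (`Iff.rfl` against the
verbatim `let`-prelude text of the `EvenSectorBarta` items), `isWeilEvenGroundState_iff_tendsto` /
`.exists_tendsto` / `.of_tendsto` (equivalence with the `Re Q(gₙ) → ε_ev(a)` form),
`forall_eventually_le_iff_tendsto_weilEvenGroundEnergy`, non-vacuity of the hypotheses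
`exists_weilEvenMinimizingSeq` (normalised even minimising sequences exist for every `a > 0`; the
even sphere itself is `exists_isWeilTest_even_sphere` of the ParitySplit file), `ae_neg_eq_self_of_tendsto`
(EVENNESS PASSES TO `L²`-LIMITS); and for `h : IsWeilEvenGroundState a u`: `.memLp`,
`.integral_norm_sq` (`∫ |u|² = 1`), `.eLpNorm_eq_one`, `.ne_zero`, `.pos` (`0 < a`), `.ae_neg`
(`u(-t) = u(t)` a.e.), `.ae_eq_zero_of_notMem`, `.ae_eq_indicator`, `.integrableOn`, `.integrable`,
`.integrable_mul_continuous`, `.integrable_mul_cexp`, `.hasDerivAt_weilMellin`,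
`.differentiable_weilMellin` (`û` is entire), `.weilMellin_one_sub` (`û(1 - s) = û(s)`: the
transform is EVEN about `1/2`), `.weilEvenGroundEnergy_le` (`ε_ev(a) ≤ Re Q(h)` for the competitors),
`.const_mul` / `.smul` / `.neg` (phases `|c| = 1`), `.congr_ae`, `.comp_neg` (`u(-·)` is again
one). NOT proved: existence `∃ u, IsWeilEvenGroundState a u`.

## References

* E. Bombieri, *Remarks on Weil's quadratic functional in the theory of prime numbers I*, Rend.
  Mat. Acc. Lincei (9) 11 (2000), 183–233: §2 p. 186 (even/odd), §4 Problem 2 and Theorem 3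
  (p. 193), Theorem 5 (p. 197), §9 Lemma 11.
* M. Suzuki, *Weil's quadratic form via the screw function*, arXiv:2606.09096 (2026), §4.5
  (arXiv p. 18), Theorem 1.4 (arXiv p. 5).
-/

noncomputable section

open Complex Filter Set MeasureTheory
open scoped Real Topology ENNReal ComplexConjugate

namespace Literature.NumberTheory.LFunctions

/-! ## The definition -/

/-- **Even-sector ground state of the truncated Weil form, operator-free.**
`IsWeilEvenGroundState a u` says that `u : ℝ → ℂ` is square integrable and is the `L²`-limit of an
`L²`-normalised sequence of EVEN test functions on the window `[-a, a]` which is minimising in the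
even sector: there are smooth compactly supported `gₙ` with `tsupport gₙ ⊆ [-a, a]`,
`gₙ(-t) = gₙ(t)`, `∫ |gₙ|² = 1`, such that for every normalised even window test `h` and every
`δ > 0` eventually `Re Q(gₙ) ≤ Re Q(h) + δ` (equivalently `Re Q(gₙ) → ε_ev(a) = weilEvenGroundEnergy a`,
`isWeilEvenGroundState_iff_tendsto`), and `∫ |gₙ − u|² → 0`. This is an even minimiser of
Bombieri's Problem 2 on `E = [e^{-a}, e^{a}]` — "Let `f(x)` be even … and a minimizer for
`T[f * f̄*]`" (proof of Thm 5, value `μ⁺(e^a)`) — encoded, as in `IsWeilGroundState` /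
`IsWeilOddGroundState`, through Thm 3's strongly `L²`-convergent minimising sequences; equivalently
a normalised bottom eigenfunction of the even part (`F(-u) = F(u)`, §9 Lemma 11; Suzuki 2026 §4.5,
`λ_a⁺`) of the form on the symmetric window. Existence is NOT part of the predicate. This is
literally the predicate inlined by the route statements `EvenOneSignedWindows` / `EvenBartaFloor`
(`isWeilEvenGroundState_iff_inline`).
[cite: Bombieri2000Weil, §4 Problem 2, Thm 3 (p. 193), Thm 5 (p. 197); §9 Lemma 11] -/
def IsWeilEvenGroundState (a : ℝ) (u : ℝ → ℂ) : Prop :=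
  MemLp u 2 ∧ ∃ g : ℕ → ℝ → ℂ,
    (∀ n, IsWeilTest (g n) ∧ tsupport (g n) ⊆ Icc (-a) a ∧ (∀ t, g n (-t) = g n t) ∧
      ∫ t, ‖g n t‖ ^ 2 = (1 : ℝ)) ∧
    (∀ h : ℝ → ℂ, IsWeilTest h → tsupport h ⊆ Icc (-a) a → (∀ t, h (-t) = h t) →
      ∫ t, ‖h t‖ ^ 2 = (1 : ℝ) → ∀ δ : ℝ, 0 < δ →
        ∀ᶠ n in atTop, (weilQuadratic (g n)).re ≤ (weilQuadratic h).re + δ) ∧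
    Tendsto (fun n ↦ ∫ t, ‖g n t - u t‖ ^ 2) atTop (𝓝 0)

/-- Unfolding: `IsWeilEvenGroundState a u` is literally the predicate `MemLp u 2 ∧ ∃ g, …` in the
directory's vocabulary (`IsWeilTest`, `weilQuadratic`). [folklore] -/
theorem isWeilEvenGroundState_iff (a : ℝ) (u : ℝ → ℂ) :
    IsWeilEvenGroundState a u ↔
      MemLp u 2 ∧ ∃ g : ℕ → ℝ → ℂ,
        (∀ n, IsWeilTest (g n) ∧ tsupport (g n) ⊆ Icc (-a) a ∧ (∀ t, g n (-t) = g n t) ∧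
          ∫ t, ‖g n t‖ ^ 2 = (1 : ℝ)) ∧
        (∀ h : ℝ → ℂ, IsWeilTest h → tsupport h ⊆ Icc (-a) a → (∀ t, h (-t) = h t) →
          ∫ t, ‖h t‖ ^ 2 = (1 : ℝ) → ∀ δ : ℝ, 0 < δ →
            ∀ᶠ n in atTop, (weilQuadratic (g n)).re ≤ (weilQuadratic h).re + δ) ∧
        Tendsto (fun n ↦ ∫ t, ‖g n t - u t‖ ^ 2) atTop (𝓝 0) :=
  Iff.rfl

/-- **The bridge to the route statements**: `IsWeilEvenGroundState a u` is DEFINITIONALLY the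
clause inlined, cone-free, by the items `EvenOneSignedWindows` / `EvenBartaFloor` of route
`EvenSectorBarta` (their `let C … let M … let Q …` prelude spells out `weilConv g (weilReflect g)`,
`weilMellin`, `weilQuadratic`, and `ContDiff ℝ ∞ g ∧ HasCompactSupport g` spells out `IsWeilTest g`;
the right-hand side below is that text verbatim). `Iff.rfl`. [folklore] -/
theorem isWeilEvenGroundState_iff_inline (a : ℝ) (u : ℝ → ℂ) :
    IsWeilEvenGroundState a u ↔
      (let C : (ℝ → ℂ) → ℝ → ℂ := fun g => MeasureTheory.convolution g (fun t => (starRingEnd ℂ) (g (-t))) (ContinuousLinearMap.mul ℂ ℂ) MeasureTheory.MeasureSpace.volume; let M : (ℝ → ℂ) → ℂ → ℂ := fun F s => ∫ t : ℝ, F t * Complex.exp ((s - 1 / 2) * t); let Q : (ℝ → ℂ) → ℂ := fun g => M (C g) 0 + M (C g) 1 - (∑' n : ℕ, ((ArithmeticFunction.vonMangoldt n : ℝ) : ℂ) / (Real.sqrt n : ℂ) * (C g (Real.log n) + C g (-Real.log n))) + ((1 / (2 * Real.pi) : ℂ) * (∫ t : ℝ, M (C g) (1 / 2 + t * Complex.I)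 * ((Complex.digamma (1 / 4 + t / 2 * Complex.I)).re : ℂ)) - C g 0 * (Real.log Real.pi : ℂ)); (MeasureTheory.MemLp u 2 ∧ ∃ g : ℕ → ℝ → ℂ, (∀ n, (ContDiff ℝ ((⊤ : ℕ∞) : WithTop ℕ∞) (g n) ∧ HasCompactSupport (g n)) ∧ tsupport (g n) ⊆ Set.Icc (-a) a ∧ (∀ t, g n (-t) = g n t) ∧ ∫ t, ‖g n t‖ ^ 2 = (1 : ℝ)) ∧ (∀ h : ℝ → ℂ, (ContDiff ℝ ((⊤ : ℕ∞) : WithTop ℕ∞) h ∧ HasCompactSupport h) → tsupport h ⊆ Set.Icc (-a) a → (∀ t, h (-t) = h t) → ∫ t, ‖h t‖ ^ 2 = (1 : ℝ) → ∀ δ : ℝ, 0 < δ → ∀ᶠ n in Filter.atTop, (Q (g n)).re ≤ (Q h).re + δ) ∧ Filter.Tendsto (fun n => ∫ t, ‖g n t - u t‖ ^ 2) Filter.atTop (nhds 0))) :=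
  Iff.rfl

/-! ## Minimising in the even sector: the junk-free clause versus `Re Q(gₙ) → ε_ev(a)` -/

/-- **The two forms of "minimising in the even sector" agree.** For a sequence `gₙ` on the even
unit sphere of the window, "for every normalised even window test `h` and `δ > 0`, eventually
`Re Q(gₙ) ≤ Re Q(h) + δ`" holds iff `Re Q(gₙ) → ε_ev(a)`: the even sphere is bounded below
(`bddBelow_weilWindowSphereValues`) and contains every `gₙ`, so `ε_ev(a) ≤ Re Q(gₙ)` always, while
competitors `h` with `Re Q(h) < ε_ev(a) + δ` exist (`exists_lt_of_csInf_lt`). (Odd twin: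
`forall_eventually_le_iff_tendsto_weilOddGroundEnergy`.) [folklore] -/
theorem forall_eventually_le_iff_tendsto_weilEvenGroundEnergy {a : ℝ} {g : ℕ → ℝ → ℂ}
    (hg : ∀ n, IsWeilTest (g n) ∧ tsupport (g n) ⊆ Icc (-a) a ∧ (∀ t, g n (-t) = g n t) ∧
      ∫ t, ‖g n t‖ ^ 2 = (1 : ℝ)) :
    (∀ h : ℝ → ℂ, IsWeilTest h → tsupport h ⊆ Icc (-a) a → (∀ t, h (-t) = h t) →
      ∫ t, ‖h t‖ ^ 2 = (1 : ℝ) → ∀ δ : ℝ, 0 < δ →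
        ∀ᶠ n in atTop, (weilQuadratic (g n)).re ≤ (weilQuadratic h).re + δ) ↔
    Tendsto (fun n ↦ (weilQuadratic (g n)).re) atTop (𝓝 (weilEvenGroundEnergy a)) := by
  set S : Set ℝ := weilWindowSphereValues (fun g ↦ ∀ t, g (-t) = g t) a with hSdef
  have hS : BddBelow S := bddBelow_weilWindowSphereValues _ a
  have hε : weilEvenGroundEnergy a = sInf S := rfl
  have hmem : ∀ n, (weilQuadratic (g n)).re ∈ S := fun n ↦
    ⟨g n, (hg n).1, (hg n).2.1, (hg n).2.2.1, (hg n).2.2.2, rfl⟩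
  have hne : S.Nonempty := ⟨_, hmem 0⟩
  have hlow : ∀ n, weilEvenGroundEnergy a ≤ (weilQuadratic (g n)).re := fun n ↦
    hε ▸ csInf_le hS (hmem n)
  constructor
  · intro H
    rw [tendsto_order]
    refine ⟨fun x hx ↦ Eventually.of_forall fun n ↦ hx.trans_le (hlow n), fun x hx ↦ ?_⟩
    have hδ : 0 < (x - weilEvenGroundEnergy a) / 2 := by linarith
    have hlt : sInf S < weilEvenGroundEnergy a + (x - weilEvenGroundEnergy a) / 2 := by
      rw [← hε]; linarith
    obtain ⟨y, ⟨h, hh, hsupp, hev, hnorm, rfl⟩, hy⟩ := exists_lt_of_csInf_lt hne hlt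
    filter_upwards [H h hh hsupp hev hnorm _ hδ] with n hn
    linarith
  · intro H h hh hsupp hev hnorm δ hδ
    have hle : weilEvenGroundEnergy a ≤ (weilQuadratic h).re :=
      weilEvenGroundEnergy_le hh hsupp hev hnorm
    have hev' : ∀ᶠ n in atTop, (weilQuadratic (g n)).re < weilEvenGroundEnergy a + δ :=
      (tendsto_order.1 H).2 _ (by linarith)
    filter_upwards [hev'] with n hn
    linarith

/-- **`IsWeilEvenGroundState` in `IsWeilGroundState` shape**: `u ∈ L²` is the `L²`-limit of an
`L²`-normalised sequence of even window tests with `Re Q(gₙ) → ε_ev(a) = weilEvenGroundEnergy a`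
(the literal even-sector twin of `isWeilGroundState_iff` / `isWeilOddGroundState_iff_tendsto`; this
is the form inlined by `Theses/EvenThetaVisibilityPinning.lean`). [folklore] -/
theorem isWeilEvenGroundState_iff_tendsto (a : ℝ) (u : ℝ → ℂ) :
    IsWeilEvenGroundState a u ↔
      MemLp u 2 ∧ ∃ g : ℕ → ℝ → ℂ,
        (∀ n, IsWeilTest (g n) ∧ tsupport (g n) ⊆ Icc (-a) a ∧ (∀ t, g n (-t) = g n t) ∧
          ∫ t, ‖g n t‖ ^ 2 = (1 : ℝ)) ∧
        Tendsto (fun n ↦ (weilQuadratic (g n)).re) atTop (𝓝 (weilEvenGroundEnergy a)) ∧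
        Tendsto (fun n ↦ ∫ t, ‖g n t - u t‖ ^ 2) atTop (𝓝 0) :=
  and_congr_right fun _ ↦ exists_congr fun _ ↦ and_congr_right fun hg ↦
    and_congr_left fun _ ↦ forall_eventually_le_iff_tendsto_weilEvenGroundEnergy hg

/-- Constructor from the `Tendsto` form. [folklore] -/
theorem IsWeilEvenGroundState.of_tendsto {a : ℝ} {u : ℝ → ℂ} (hu : MemLp u 2) {g : ℕ → ℝ → ℂ}
    (hg : ∀ n, IsWeilTest (g n) ∧ tsupport (g n) ⊆ Icc (-a) a ∧ (∀ t, g n (-t) = g n t) ∧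
      ∫ t, ‖g n t‖ ^ 2 = (1 : ℝ))
    (hQ : Tendsto (fun n ↦ (weilQuadratic (g n)).re) atTop (𝓝 (weilEvenGroundEnergy a)))
    (hlim : Tendsto (fun n ↦ ∫ t, ‖g n t - u t‖ ^ 2) atTop (𝓝 0)) :
    IsWeilEvenGroundState a u :=
  (isWeilEvenGroundState_iff_tendsto a u).2 ⟨hu, g, hg, hQ, hlim⟩

/-- **Even minimising sequences exist**: for every window `a > 0` there is an `L²`-normalised
sequence of even test functions `gₙ` on `[-a, a]` with `Re Q(gₙ) → ε_ev(a)` (the even sphere is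
nonempty, `exists_isWeilTest_even_sphere`, and bounded below; `exists_seq_tendsto_sInf`). So
`IsWeilEvenGroundState a u` asks exactly for the `L²`-CONVERGENCE of such a sequence to `u`
(Bombieri's Thm 3 in the even sector, not proved here).
[cite: Bombieri2000Weil, §4 Thm 3 (proof, first paragraph, p. 193) and Thm 5 (p. 197)] -/
theorem exists_weilEvenMinimizingSeq {a : ℝ} (ha : 0 < a) :
    ∃ g : ℕ → ℝ → ℂ,
      (∀ n, IsWeilTest (g n) ∧ tsupport (g n) ⊆ Icc (-a) a ∧ (∀ t, g n (-t) = g n t) ∧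
        ∫ t, ‖g n t‖ ^ 2 = (1 : ℝ)) ∧
      Tendsto (fun n ↦ (weilQuadratic (g n)).re) atTop (𝓝 (weilEvenGroundEnergy a)) := by
  set S : Set ℝ := weilWindowSphereValues (fun g ↦ ∀ t, g (-t) = g t) a with hSdef
  have hne : S.Nonempty := weilWindowSphereValues_even_nonempty ha
  have hbdd : BddBelow S := bddBelow_weilWindowSphereValues _ a
  obtain ⟨x, -, hx, hmem⟩ := exists_seq_tendsto_sInf hne hbdd
  have hmem' : ∀ n, ∃ g : ℝ → ℂ, IsWeilTest g ∧ tsupport g ⊆ Icc (-a) a ∧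
      (∀ t, g (-t) = g t) ∧ ∫ t : ℝ, ‖g t‖ ^ 2 = 1 ∧ x n = (weilQuadratic g).re := hmem
  choose g hg hsupp hev hnorm hxg using hmem'
  refine ⟨g, fun n ↦ ⟨hg n, hsupp n, hev n, hnorm n⟩, ?_⟩
  have hfun : (fun n ↦ (weilQuadratic (g n)).re) = x := funext fun n ↦ (hxg n).symm
  rw [hfun]
  exact hx

/-! ## Evenness passes to `L²`-limits -/

/-- **Evenness passes to `L²`-limits**: if even square-integrable `gₙ` converge to `u ∈ L²` in
`L²`, then `u(-t) = u(t)` for a.e. `t`. Indeed `u(t) − u(-t) = (u − gₙ)(t) − (u − gₙ)(-t)`, so by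
Minkowski and reflection invariance of Lebesgue measure `‖u − u(-·)‖₂ ≤ 2 ‖gₙ − u‖₂ → 0`.
(Odd twin: `ae_neg_eq_neg_of_tendsto`.) [folklore] -/
theorem ae_neg_eq_self_of_tendsto {u : ℝ → ℂ} (hu : MemLp u 2) {g : ℕ → ℝ → ℂ}
    (hgm : ∀ n, MemLp (g n) 2) (hev : ∀ n t, g n (-t) = g n t)
    (hlim : Tendsto (fun n ↦ ∫ t, ‖g n t - u t‖ ^ 2) atTop (𝓝 0)) :
    ∀ᵐ t : ℝ, u (-t) = u t := by
  have hu' : MemLp (fun t ↦ u (-t)) 2 :=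
    hu.comp_measurePreserving (Measure.measurePreserving_neg (volume : Measure ℝ))
  have hwm : MemLp (fun t ↦ u t - u (-t)) 2 := hu.sub hu'
  -- the reflected distance equals the distance
  have hrefl : ∀ n, ∫ t, ‖g n t - u (-t)‖ ^ 2 = ∫ t, ‖g n t - u t‖ ^ 2 := fun n ↦ by
    have h := integral_neg_eq_self (fun t ↦ ‖g n t - u t‖ ^ 2) (volume : Measure ℝ)
    simpa only [hev n] using h
  have hle : ∀ n, Real.sqrt (∫ t, ‖u t - u (-t)‖ ^ 2) ≤
      2 * Real.sqrt (∫ t, ‖g n t - u t‖ ^ 2) := fun n ↦ by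
    have key := sqrt_integral_norm_sq_sub_le (f := fun t ↦ u t - g n t)
      (h := fun t ↦ u (-t) - g n t) (hu.sub (hgm n)) (hu'.sub (hgm n))
    have e1 : ∀ t, u t - g n t - (u (-t) - g n t) = u t - u (-t) := fun t ↦ by ring
    have e2 : ∫ t, ‖u t - g n t‖ ^ 2 = ∫ t, ‖g n t - u t‖ ^ 2 :=
      integral_congr_ae (Eventually.of_forall fun t ↦ by simp only [norm_sub_rev])
    have e3 : ∫ t, ‖u (-t) - g n t‖ ^ 2 = ∫ t, ‖g n t - u t‖ ^ 2 := by
      rw [← hrefl n]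
      exact integral_congr_ae (Eventually.of_forall fun t ↦ by simp only [norm_sub_rev])
    simp only [e1] at key
    rw [e2, e3] at key
    linarith
  have hlim' : Tendsto (fun n ↦ 2 * Real.sqrt (∫ t, ‖g n t - u t‖ ^ 2)) atTop (𝓝 0) := by
    simpa using (hlim.sqrt.const_mul 2)
  have h0 : Real.sqrt (∫ t, ‖u t - u (-t)‖ ^ 2) ≤ 0 := ge_of_tendsto' hlim' hle
  have hI0 : ∫ t, ‖u t - u (-t)‖ ^ 2 = 0 :=
    le_antisymm (Real.sqrt_eq_zero'.1 (le_antisymm h0 (Real.sqrt_nonneg _)))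
      (integral_nonneg fun _ ↦ by positivity)
  have hw2 : Integrable (fun t ↦ ‖u t - u (-t)‖ ^ 2) :=
    (memLp_two_iff_integrable_sq_norm hwm.1).1 hwm
  have hae : (fun t ↦ ‖u t - u (-t)‖ ^ 2) =ᵐ[volume] 0 :=
    (integral_eq_zero_iff_of_nonneg (fun _ ↦ by positivity) hw2).1 hI0
  filter_upwards [hae] with t ht
  have ht' : u t - u (-t) = 0 := by simpa using ht
  exact (sub_eq_zero.1 ht').symm

/-! ## API of `IsWeilEvenGroundState` -/

namespace IsWeilEvenGroundState

variable {a : ℝ} {u v : ℝ → ℂ}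

/-- An even-sector ground state is square integrable. [folklore] -/
theorem memLp (h : IsWeilEvenGroundState a u) : MemLp u 2 :=
  h.1

/-- **The approximating sequence, `Tendsto` form**: even normalised window tests `gₙ` with
`Re Q(gₙ) → ε_ev(a)` and `∫ |gₙ − u|² → 0`. [folklore] -/
theorem exists_tendsto (h : IsWeilEvenGroundState a u) :
    ∃ g : ℕ → ℝ → ℂ,
      (∀ n, IsWeilTest (g n) ∧ tsupport (g n) ⊆ Icc (-a) a ∧ (∀ t, g n (-t) = g n t) ∧
        ∫ t, ‖g n t‖ ^ 2 = (1 : ℝ)) ∧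
      Tendsto (fun n ↦ (weilQuadratic (g n)).re) atTop (𝓝 (weilEvenGroundEnergy a)) ∧
      Tendsto (fun n ↦ ∫ t, ‖g n t - u t‖ ^ 2) atTop (𝓝 0) :=
  ((isWeilEvenGroundState_iff_tendsto a u).1 h).2

/-- **Normalisation** `∫ |u|² = 1` (the strong `L²`-limit of a normalised sequence stays on the
unit sphere). [cite: Bombieri2000Weil, §4 Thm 3 (proof, p. 193) and Thm 5 ("of norm 1", p. 197)] -/
theorem integral_norm_sq (h : IsWeilEvenGroundState a u) : ∫ t, ‖u t‖ ^ 2 = 1 := by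
  obtain ⟨hu, g, hg, -, hlim⟩ := h
  exact integral_norm_sq_eq_one_of_tendsto hu
    (fun n ↦ (hg n).1.1.continuous.memLp_of_hasCompactSupport (hg n).1.2)
    (fun n ↦ (hg n).2.2.2) hlim

/-- `‖u‖_{L²} = 1` in `eLpNorm` form. [folklore] -/
theorem eLpNorm_eq_one (h : IsWeilEvenGroundState a u) : eLpNorm u 2 volume = 1 := by
  rw [eLpNorm_two_eq_ofReal_sqrt h.memLp, h.integral_norm_sq, Real.sqrt_one, ENNReal.ofReal_one]

/-- An even-sector ground state is not the zero function. [folklore] -/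
theorem ne_zero (h : IsWeilEvenGroundState a u) : u ≠ 0 := by
  intro hu
  have := h.integral_norm_sq
  simp [hu] at this

/-- **The window is non-degenerate**: `IsWeilEvenGroundState a u → 0 < a` (for `a ≤ 0` a window
test function vanishes, `IsWeilTest.eq_zero_of_tsupport_subset`, and cannot have `∫ |g|² = 1`).
[folklore] -/
theorem pos (h : IsWeilEvenGroundState a u) : 0 < a := by
  obtain ⟨-, g, hg, -, -⟩ := h
  by_contra ha
  have h0 : g 0 = 0 := (hg 0).1.eq_zero_of_tsupport_subset (hg 0).2.1 (not_lt.1 ha)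
  have h1 := (hg 0).2.2.2
  simp [h0] at h1

/-- **Evenness passes to the limit**: an even-sector ground state satisfies `u(-t) = u(t)` for
a.e. `t` (Bombieri 2000 §9 Lemma 11: the even eigenfunctions satisfy `F(-u) = F(u)`; Suzuki 2026
§4.5: `E(λ) = E⁺(λ) ⊕ E⁻(λ)`). [cite: Bombieri2000Weil, §9 Lemma 11] -/
theorem ae_neg (h : IsWeilEvenGroundState a u) : ∀ᵐ t : ℝ, u (-t) = u t := by
  obtain ⟨hu, g, hg, -, hlim⟩ := h
  exact ae_neg_eq_self_of_tendsto hu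
    (fun n ↦ (hg n).1.1.continuous.memLp_of_hasCompactSupport (hg n).1.2)
    (fun n ↦ (hg n).2.2.1) hlim

/-- `a.e.`-evenness as an `EventuallyEq`: `u ∘ (-·) = u` a.e. [folklore] -/
theorem comp_neg_ae_eq (h : IsWeilEvenGroundState a u) :
    (fun t ↦ u (-t)) =ᵐ[volume] u :=
  h.ae_neg

/-- **Localisation**: an even-sector ground state vanishes a.e. off the window `[-a, a]` (it is an
`L²`-limit of functions supported in the window; Bombieri 2000 §4: the minimiser lies in `L²(E)`).
[cite: Bombieri2000Weil, §4 Problem 2 and Thm 3 (p. 193)] -/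
theorem ae_eq_zero_of_notMem (h : IsWeilEvenGroundState a u) :
    ∀ᵐ t : ℝ, t ∉ Icc (-a) a → u t = 0 := by
  obtain ⟨hu, g, hg, -, hlim⟩ := h
  exact ae_eq_zero_of_tendsto_integral_norm_sq_sub measurableSet_Icc hu
    (fun n ↦ (hg n).1.1.continuous.memLp_of_hasCompactSupport (hg n).1.2)
    (fun n t ht ↦ image_eq_zero_of_notMem_tsupport fun h' ↦ ht ((hg n).2.1 h')) hlim

/-- An even-sector ground state agrees a.e. with its truncation to the window. [folklore] -/
theorem ae_eq_indicator (h : IsWeilEvenGroundState a u) :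
    u =ᵐ[volume] (Icc (-a) a).indicator u := by
  filter_upwards [h.ae_eq_zero_of_notMem] with t ht
  by_cases hm : t ∈ Icc (-a) a
  · simp [hm]
  · simp [hm, ht hm]

/-- An even-sector ground state is integrable on its window (`L² ⊆ L¹` there). [folklore] -/
theorem integrableOn (h : IsWeilEvenGroundState a u) : IntegrableOn u (Icc (-a) a) :=
  (h.memLp.restrict (Icc (-a) a)).integrable one_le_two

/-- An even-sector ground state is integrable on `ℝ`. [folklore] -/
theorem integrable (h : IsWeilEvenGroundState a u) : Integrable u :=
  h.integrableOn.integrable_of_ae_notMem_eq_zero h.ae_eq_zero_of_notMem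

/-- `u · w` is integrable for every continuous `w`. [folklore] -/
theorem integrable_mul_continuous (h : IsWeilEvenGroundState a u) {w : ℝ → ℂ}
    (hw : Continuous w) : Integrable fun t ↦ u t * w t :=
  integrable_mul_continuous_of_ae_eq_zero h.integrableOn h.ae_eq_zero_of_notMem hw

/-- **Exponential moments**: `t ↦ u(t) e^{ct}` is integrable for every `c : ℂ` (in particular the
integrand of `weilMellin u s`, every `s`). [folklore] -/
theorem integrable_mul_cexp (h : IsWeilEvenGroundState a u) (c : ℂ) :
    Integrable fun t : ℝ ↦ u t * cexp (c * t) :=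
  h.integrable_mul_continuous (by fun_prop)

/-- `û` is complex differentiable everywhere, `û'(s) = ∫ u(t) t e^{(s-1/2)t} dt`.
[cite: Bombieri2000Weil, §4 Lemma 4 and Thm 3 (proof)] -/
theorem hasDerivAt_weilMellin (h : IsWeilEvenGroundState a u) (s₀ : ℂ) :
    HasDerivAt (weilMellin u) (∫ t : ℝ, u t * (t * cexp ((s₀ - 1 / 2) * t))) s₀ :=
  hasDerivAt_weilMellin_of_ae_eq_zero h.integrableOn h.ae_eq_zero_of_notMem s₀

/-- **The transform `û = weilMellin u` of an even-sector ground state is entire.** [folklore] -/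
theorem differentiable_weilMellin (h : IsWeilEvenGroundState a u) :
    Differentiable ℂ (weilMellin u) :=
  fun s ↦ (h.hasDerivAt_weilMellin s).differentiableAt

/-- **The transform is even about `1/2`**: `û(1 - s) = û(s)` (substitute `t ↦ -t`,
`weilMellin_comp_neg`, and use a.e. evenness; Bombieri's `f̃*(s) = f̃(1 - s)` with `f* = f`).
[cite: Bombieri2000Weil, §2 (p. 186)] -/
theorem weilMellin_one_sub (h : IsWeilEvenGroundState a u) (s : ℂ) :
    weilMellin u (1 - s) = weilMellin u s := by
  rw [← weilMellin_comp_neg u s]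
  unfold weilMellin
  refine integral_congr_ae ?_
  filter_upwards [h.ae_neg] with t ht
  rw [ht]

/-- The values at the two poles agree: `û(0) = û(1)` (so the polar side of the explicit formula
for `u` is `2 û(1)`). [folklore] -/
theorem weilMellin_zero_eq_one (h : IsWeilEvenGroundState a u) : weilMellin u 0 = weilMellin u 1 := by
  have h1 := h.weilMellin_one_sub 1
  rwa [sub_self] at h1

/-- **Competitors bound the energy**: along the approximating sequence of an even-sector ground
state, `Re Q(gₙ)` is eventually below `Re Q(h) + δ` for every normalised even window test `h`;
in energy form, `ε_ev(a) ≤ Re Q(h)` (`weilEvenGroundEnergy_le` of the ParitySplit file, restated on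
the predicate's data for convenience). [folklore] -/
theorem weilEvenGroundEnergy_le (_h : IsWeilEvenGroundState a u) {k : ℝ → ℂ} (hk : IsWeilTest k)
    (hsupp : tsupport k ⊆ Icc (-a) a) (hev : ∀ t, k (-t) = k t)
    (hnorm : ∫ t, ‖k t‖ ^ 2 = (1 : ℝ)) :
    weilEvenGroundEnergy a ≤ (weilQuadratic k).re :=
  Literature.NumberTheory.LFunctions.weilEvenGroundEnergy_le hk hsupp hev hnorm

/-- **Phase invariance**: if `u` is an even-sector ground state then so is `c u` for every
constant `|c| = 1` (even minimising sequence `c gₙ`; `Q(c g) = |c|² Q(g)`, `weilQuadratic_const_mul`).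
[folklore] -/
theorem const_mul (h : IsWeilEvenGroundState a u) {c : ℂ} (hc : ‖c‖ = 1) :
    IsWeilEvenGroundState a (fun t ↦ c * u t) := by
  obtain ⟨hu, g, hg, hQ, hlim⟩ := h
  have hc2 : (Complex.normSq c : ℂ) = 1 := by
    rw [Complex.normSq_eq_norm_sq, hc]
    simp
  refine ⟨hu.const_mul c, fun n t ↦ c * g n t, fun n ↦ ⟨(hg n).1.const_mul c,
    tsupport_mul_subset_right.trans (hg n).2.1,
    fun t ↦ by beta_reduce; rw [(hg n).2.2.1 t], ?_⟩,
    ?_, ?_⟩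
  · simpa only [norm_mul, mul_pow, hc, one_pow, one_mul] using (hg n).2.2.2
  · intro k hk hsupp hev hnorm δ hδ
    simpa only [weilQuadratic_const_mul, hc2, one_mul] using hQ k hk hsupp hev hnorm δ hδ
  · simpa only [← mul_sub, norm_mul, mul_pow, hc, one_pow, one_mul] using hlim

/-- Phase invariance, `•` form: `IsWeilEvenGroundState a (c • u)` for `‖c‖ = 1`. [folklore] -/
theorem smul (h : IsWeilEvenGroundState a u) {c : ℂ} (hc : ‖c‖ = 1) :
    IsWeilEvenGroundState a (c • u) :=
  h.const_mul hc

/-- In particular `-u` is an even-sector ground state with `u`. [folklore] -/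
theorem neg (h : IsWeilEvenGroundState a u) : IsWeilEvenGroundState a (fun t ↦ -u t) := by
  simpa using h.const_mul (c := -1) (by simp)

/-- **Invariance under modification on a null set**: the predicate only sees `u` through `MemLp`
and `∫ |gₙ − u|²`. [folklore] -/
theorem congr_ae (h : IsWeilEvenGroundState a u) (huv : u =ᵐ[volume] v) :
    IsWeilEvenGroundState a v := by
  obtain ⟨hu, g, hg, hQ, hlim⟩ := h
  refine ⟨hu.ae_eq huv, g, hg, hQ, ?_⟩
  have he : ∀ n, ∫ t, ‖g n t - v t‖ ^ 2 = ∫ t, ‖g n t - u t‖ ^ 2 := fun n ↦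
    integral_congr_ae (huv.mono fun t ht ↦ by simp [ht])
  simpa only [he] using hlim

/-- **Reflection invariance**: with `u`, its reflection `u(-·)` is an even-sector ground state
(it agrees with `u` a.e., `ae_neg`). [folklore] -/
theorem comp_neg (h : IsWeilEvenGroundState a u) : IsWeilEvenGroundState a (fun t ↦ u (-t)) :=
  h.congr_ae h.comp_neg_ae_eq.symm

end IsWeilEvenGroundState

/-- `IsWeilEvenGroundState a` is a property of the a.e.-class of `u`. [folklore] -/
theorem isWeilEvenGroundState_congr_ae {a : ℝ} {u v : ℝ → ℂ} (huv : u =ᵐ[volume] v) :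
    IsWeilEvenGroundState a u ↔ IsWeilEvenGroundState a v :=
  ⟨fun h ↦ h.congr_ae huv, fun h ↦ h.congr_ae huv.symm⟩

/-- The zero function is never an even-sector ground state. [folklore] -/
theorem not_isWeilEvenGroundState_zero (a : ℝ) : ¬ IsWeilEvenGroundState a 0 :=
  fun h ↦ h.ne_zero rfl

/-- There are no even-sector ground states on a degenerate window `a ≤ 0`. [folklore] -/
theorem not_isWeilEvenGroundState_of_nonpos {a : ℝ} (ha : a ≤ 0) (u : ℝ → ℂ) :
    ¬ IsWeilEvenGroundState a u :=
  fun h ↦ (not_lt.2 ha) h.pos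

end Literature.NumberTheory.LFunctions

end
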